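import Mathlib.Analysis.Calculus.MeanValue
import Literature.Geometry.Lorentzian.KerrSchildLocalEnergy
import Literature.Geometry.Lorentzian.KerrDependenceWeights
import Literature.Geometry.Lorentzian.KerrWaveEnergyProofs
import HarnessLib

/-!
# Finite speed of propagation in the ingoing Kerr–Schild chart: discharge of the named fact
# `kerr_finite_speed_of_propagation`

(family `gr`, statement **gr.S24** infrastructure; namespaces `Literature.Geometry.Lorentzian`,
`Literature.Geometry.Lorentzian.Kerr`)

`KerrWaveEnergy.lean` vendors, as the named fact `kerr_finite_speed_of_propagation`, the domain of
dependence property of the leaf `{t* = 0} ∩ {r > r₊}` of the ingoing Kerr–Schild chart of a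
subextremal Kerr exterior: a smooth solution of `□_g ψ = 0` on `{r > r₊}` whose Cauchy data vanish
on `{t* = 0, ‖x⃗‖ > ρ}` vanishes, with its differential, at every exterior point with `t* ≥ 0` and
`‖x⃗‖ > ρ + t*` (Bär–Ginoux–Pfäffle 2007, Thm. 3.2.11 and Cor. 3.2.4 = arXiv:0806.1036, Ch. 3,
Sect. 2, Thm. 2.9 and Cor. 2.4: on a globally hyperbolic manifold solutions of normally hyperbolic
equations are determined by their Cauchy data and `supp u ⊂ J(supp data)`; O'Neill 1983, Ch. 14,
Thm. 38, Lemma 43: Cauchy developments). This file **proves** it: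
`Literature.Geometry.Lorentzian.kerr_finite_speed_of_propagation_holds`.

## Proof (energy method; Hawking–Ellis 1973, §4.3, conservation theorem)

Fix an exterior point `x = (t₀, y₀)`, `t₀ > 0`, `‖y₀‖ > ρ + t₀`, and pick `t₀ < R < ‖y₀‖ − ρ`,
`0 < ε₁ < R − t₀`, `ε = (r(x) − r₊)/2`. The solution is transported to the surgered Kerr–Schild
background `B = Kerr.surgeryBackground M a r₊` on `ℝ⁴` (`KerrSchildWaveCauchyProblem.lean`), whose
divergence-form wave operator is `□_g` on the chart (`Kerr.dalembertian_eq_waveOperator`). The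
weighted conservation theorem `KerrSchild.Background.fderiv_eq_zero_of_weight`
(`KerrSchildLocalEnergy.lean`) is applied with the weight
`W = χ(2t* + 2) · χ(R − t* − (ε₁² + ‖y − y₀‖²)^{1/2}) · χ(δ⁻¹(r − r_in(t*)))`,
`r_in(t*) = r₊ + ε e^{(t* − t₀)/(2M)}`, `δ = ε e^{−t₀/(2M)}` (`χ` = `Real.smoothTransition`;
`KerrDependenceWeights.lean`): it is `C¹`, nonnegative, supported over `t* ≥ −1` in a compact subset of
`{r > r₊}`, positive along the segment `[0, t₀] × {y₀}`, its initial support lies in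
`{‖y‖ > ρ} ∩ {r > r₊}` where the data vanish, and its differential has nonpositive pairing with the
`dt*`-current `T^{μ0}` by the dominant energy condition (`KerrSchildDominantEnergy.lean`): the cone
factor has conormal `dt* + n⃗·dy⃗`, `|n⃗| < 1` (the Kerr–Schild cones lie inside the Minkowski
cones, `H ≥ 0`), and the horizon factor has conormal `ṙ_in dt* − dr` with `ṙ_in = (r_in − r₊)/(2M)`,
past causal in the layer `r ≤ r_in + δ` by `Kerr.horizonCovector_causal`
(`Δ(r) ≤ r(r − r₊) ≤ 4Mr ṙ_in`; past causal curves in `{r > r₊}` do not reach `𝓗⁺` in finite `t*`,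
DRSR arXiv:1402.7034, §2.2.5). Hence `dψ = 0` along the segment and `ψ(x) = ψ(0, y₀) = 0`.

## References

* C. Bär, N. Ginoux, F. Pfäffle, *Wave equations on Lorentzian manifolds and quantization*, EMS
  2007 (arXiv:0806.1036): Ch. 3, Sect. 2, Cor. 2.4 (uniqueness for the Cauchy problem) and
  Thm. 2.9 (`supp u ⊂ J^M(K)`) of the arXiv version = Cor. 3.2.4, Thm. 3.2.11 of the book
  (key `BarGinouxPfaffle2007`).
* S. W. Hawking, G. F. R. Ellis, *The large scale structure of space-time*, CUP 1973, §4.3,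
  Lemma 4.3.1 and the conservation theorem (key `HawkingEllis1973CUP`).
* M. Dafermos, I. Rodnianski, Y. Shlapentokh-Rothman, arXiv:1402.7034, §2.2.5
  (key `DafermosRodnianskiShlapentokhrothman2014`).
* B. O'Neill, *Semi-Riemannian geometry*, 1983, Ch. 14, Thm. 38, Lemma 43
  (key `ONeillSemiRiemannian1983`).
-/

noncomputable section

open Set Filter
open scoped ContDiff Topology Manifold

namespace Literature.Geometry.Lorentzian

open _root_.MeasureTheory Metric

namespace Kerr

/-! ### The weight `W = χ(2t* + 2) χ(q₁) χ(q₂)`: smoothness, support, positivity, flux sign -/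

/-- **The weight is smooth on `ℝ⁴`** (the horizon factor vanishes identically near `{r ≤ r_p}`,
where the Kerr–Schild radius is not smooth; `Kerr.contDiff_of_eq_zero_of_radius_lt`). [folklore] -/
theorem contDiff_dependenceWeight {a rp M t₀ R ε₁ ε δ : ℝ} (y₀ : E3) (hε₁ : ε₁ ≠ 0) (hrp : 0 < rp)
    (hε : 0 ≤ ε) (hδ : 0 < δ) {n : ℕ∞} :
    ContDiff ℝ n fun w : E4 ↦ Real.smoothTransition (2 * w 0 + 2) *
      (Real.smoothTransition (R - w 0 - √(ε₁ ^ 2 + ‖E4.spatial w - y₀‖ ^ 2)) *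
        Real.smoothTransition
          (δ⁻¹ * (radius a w - (rp + ε * Real.exp ((w 0 - t₀) / (2 * M)))))) := by
  refine contDiff_slabTimeCutoff.mul
    ((Real.smoothTransition.contDiff.comp (contDiff_coneArg hε₁ R y₀)).mul ?_)
  refine contDiff_of_eq_zero_of_radius_lt (a := a) (c := rp) hrp (fun w hw ↦ ?_) (fun w hw ↦ ?_)
  · refine Real.smoothTransition.zero_of_nonpos (mul_nonpos_of_nonneg_of_nonpos
      (inv_nonneg.mpr hδ.le) ?_)
    have : 0 ≤ ε * Real.exp ((w 0 - t₀) / (2 * M)) := mul_nonneg hε (Real.exp_pos _).le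
    linarith
  · have hr : 0 < radius a w := by linarith
    exact Real.smoothTransition.contDiff.contDiffAt.comp w (contDiffAt_horizonArg rp ε t₀ M δ hr)

/-- **The weight is nonnegative.** [folklore] -/
theorem dependenceWeight_nonneg (a rp M t₀ R ε₁ ε δ : ℝ) (y₀ : E3) (w : E4) :
    0 ≤ Real.smoothTransition (2 * w 0 + 2) *
      (Real.smoothTransition (R - w 0 - √(ε₁ ^ 2 + ‖E4.spatial w - y₀‖ ^ 2)) *
        Real.smoothTransition
          (δ⁻¹ * (radius a w - (rp + ε * Real.exp ((w 0 - t₀) / (2 * M)))))) :=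
  mul_nonneg (Real.smoothTransition.nonneg _)
    (mul_nonneg (Real.smoothTransition.nonneg _) (Real.smoothTransition.nonneg _))

/-- **Support of the weight**: where `W ≠ 0` one has `t* > −1`, `‖y − y₀‖ < R − t*` and
`r > r_in(t*)` (the three transitions are zero on nonpositive arguments). [folklore] -/
theorem dependenceWeight_support {a rp M t₀ R ε₁ ε δ : ℝ} {y₀ : E3} (hδ : 0 < δ) {w : E4}
    (hw : Real.smoothTransition (2 * w 0 + 2) *
      (Real.smoothTransition (R - w 0 - √(ε₁ ^ 2 + ‖E4.spatial w - y₀‖ ^ 2)) *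
        Real.smoothTransition
          (δ⁻¹ * (radius a w - (rp + ε * Real.exp ((w 0 - t₀) / (2 * M)))))) ≠ 0) :
    -1 < w 0 ∧ ‖E4.spatial w - y₀‖ < R - w 0 ∧
      rp + ε * Real.exp ((w 0 - t₀) / (2 * M)) < radius a w := by
  obtain ⟨h1, h23⟩ := mul_ne_zero_iff.mp hw
  obtain ⟨h2, h3⟩ := mul_ne_zero_iff.mp h23
  refine ⟨neg_one_lt_of_slabTimeCutoff_ne_zero h1, ?_, ?_⟩
  · have hq : 0 < R - w 0 - √(ε₁ ^ 2 + ‖E4.spatial w - y₀‖ ^ 2) := by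
      by_contra hle
      exact h2 (Real.smoothTransition.zero_of_nonpos (not_lt.mp hle))
    have := norm_le_sqrt_sq_add_norm_sq ε₁ (E4.spatial w - y₀)
    linarith
  · have hq : 0 < δ⁻¹ * (radius a w - (rp + ε * Real.exp ((w 0 - t₀) / (2 * M)))) := by
      by_contra hle
      exact h3 (Real.smoothTransition.zero_of_nonpos (not_lt.mp hle))
    have := (mul_pos_iff_of_pos_left (inv_pos.mpr hδ)).mp hq
    linarith

/-- **The weight is positive along the segment `[0, t₀] × {y₀}`** when `0 < ε₁ < R − t₀` and
`r(y₀) > r_p + ε` (`M > 0`). [folklore] -/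
theorem dependenceWeight_ne_zero_segment {a rp M t₀ R ε₁ ε δ : ℝ} {y₀ : E3} (hM : 0 < M)
    (hε₁ : 0 < ε₁) (hε₁R : ε₁ < R - t₀) (hε : 0 ≤ ε) (hδ : 0 < δ) {t : ℝ} (ht0 : 0 ≤ t)
    (ht : t ≤ t₀) (hr : rp + ε < radius a (E4.ofTimeSpace t y₀)) :
    Real.smoothTransition (2 * (E4.ofTimeSpace t y₀) 0 + 2) *
      (Real.smoothTransition
          (R - (E4.ofTimeSpace t y₀) 0 - √(ε₁ ^ 2 + ‖E4.spatial (E4.ofTimeSpace t y₀) - y₀‖ ^ 2)) *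
        Real.smoothTransition
          (δ⁻¹ * (radius a (E4.ofTimeSpace t y₀) -
            (rp + ε * Real.exp (((E4.ofTimeSpace t y₀) 0 - t₀) / (2 * M)))))) ≠ 0 := by
  simp only [E4.ofTimeSpace_apply_zero, E4.spatial_ofTimeSpace, sub_self, norm_zero]
  refine mul_ne_zero (Real.smoothTransition.pos_of_pos (by linarith)).ne'
    (mul_ne_zero (Real.smoothTransition.pos_of_pos ?_).ne'
      (Real.smoothTransition.pos_of_pos ?_).ne')
  · have : √(ε₁ ^ 2 + (0 : ℝ) ^ 2) = ε₁ := by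
      rw [zero_pow two_ne_zero, add_zero, Real.sqrt_sq hε₁.le]
    rw [this]
    linarith
  · refine mul_pos (inv_pos.mpr hδ) ?_
    have hexp : Real.exp ((t - t₀) / (2 * M)) ≤ 1 := by
      rw [Real.exp_le_one_iff]
      exact div_nonpos_of_nonpos_of_nonneg (by linarith) (by linarith)
    nlinarith [Real.exp_pos ((t - t₀) / (2 * M))]

/-- **The flux condition for the weight on the Kerr exterior.** At a point `w` with `r > r₊` and
`t* ≥ 0` (where the time cutoff is `≡ 1`), for every function `Φ`,
`∑_μ ∂_μW(w) T^{μ0}[Φ](w) ≤ 0`, the current being that of the surgered Kerr–Schild background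
`B = Kerr.surgeryBackground M a r₊` (whose metric at `w` is the Kerr metric). By
`sum_fderiv_smoothTransition_mul_le` it suffices that the pairings of `dq₁` and (in the layer
`q₂ ≤ 1`, i.e. `r ≤ r_in + δ`) of `dq₂` with the current are `≤ 0`, which is the dominant energy
condition `KerrSchild.Background.sum_mul_normalCurrent_nonneg` for the past causal covectors
`−dq₁ = dt* + n⃗·dy⃗` (`coneArg_covector`, `coneCovector_causal`) and
`−δ dq₂ = ṙ_in dt* − dr` (`horizonCovector_causal`, with `Δ(r) ≤ r(r − r₊) ≤ 4Mr ṙ_in` in the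
layer since `r − r₊ ≤ (r_in − r₊) + δ ≤ 2(r_in − r₊) = 4M ṙ_in` for `t* ≥ 0`). Hawking–Ellis 1973,
§4.3, Lemma 4.3.1 (the lateral boundary `(∂𝒰)₂` has non-spacelike normal form with
`n_a t_{;b} g^{ab} < 0`). [cite: HawkingEllis1973CUP, §4.3 Lemma 4.3.1] -/
theorem dependenceWeight_flux_nonpos {M a : ℝ} (hMa : IsSubextremal M a) (hM : 0 ≤ M)
    (hrp : 0 < rPlus M a) {t₀ R ε₁ ε δ : ℝ} (hε₁ : ε₁ ≠ 0) (hε : 0 < ε)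
    (hδ : δ = ε * Real.exp (-t₀ / (2 * M))) (y₀ : E3) (Φ : E4 → ℝ) {w : E4}
    (hw : rPlus M a < radius a w) (hw0 : 0 ≤ w 0) :
    ∑ μ, fderiv ℝ (fun w : E4 ↦ Real.smoothTransition (2 * w 0 + 2) *
        (Real.smoothTransition (R - w 0 - √(ε₁ ^ 2 + ‖E4.spatial w - y₀‖ ^ 2)) *
          Real.smoothTransition
            (δ⁻¹ * (radius a w - (rPlus M a + ε * Real.exp ((w 0 - t₀) / (2 * M))))))) w
        (E4.basisVector μ) *
      KerrSchild.normalCurrent (surgeryBackground M a (rPlus M a) hM hrp).inverseMetric Φ w μ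
        ≤ 0 := by
  have hMpos : 0 < M := hMa.pos
  have hδ0 : 0 < δ := by rw [hδ]; exact mul_pos hε (Real.exp_pos _)
  set B := surgeryBackground M a (rPlus M a) hM hrp with hB
  have hr0 : 0 < radius a w := hrp.trans hw
  set P : Fin 4 → ℝ := fun μ ↦ KerrSchild.normalCurrent B.inverseMetric Φ w μ with hP
  set q₁ : E4 → ℝ := fun w' ↦ R - w' 0 - √(ε₁ ^ 2 + ‖E4.spatial w' - y₀‖ ^ 2) with hq₁
  set q₂ : E4 → ℝ := fun w' ↦
    δ⁻¹ * (radius a w' - (rPlus M a + ε * Real.exp ((w' 0 - t₀) / (2 * M)))) with hq₂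
  -- near `w` the time cutoff is `1`
  have hWev : (fun w' : E4 ↦ Real.smoothTransition (2 * w' 0 + 2) *
      (Real.smoothTransition (q₁ w') * Real.smoothTransition (q₂ w'))) =ᶠ[𝓝 w]
      fun w' ↦ Real.smoothTransition (q₁ w') * Real.smoothTransition (q₂ w') := by
    filter_upwards [slabTimeCutoff_eventuallyEq_one (show -2⁻¹ < w 0 by linarith)] with w' hw'
    rw [hw', one_mul]
  have hq₁d : DifferentiableAt ℝ q₁ w := (coneArg_hasFDerivAt hε₁ R y₀ w).differentiableAt
  have hq₂d : DifferentiableAt ℝ q₂ w :=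
    (horizonArg_hasFDerivAt (rPlus M a) ε t₀ M δ hr0).differentiableAt
  refine sum_fderiv_smoothTransition_mul_le P hWev hq₁d hq₂d ?_ ?_
  · -- the cone factor: `−dq₁` is a cone covector
    obtain ⟨hν0, hn⟩ := coneArg_covector hε₁ R y₀ w
    have hc := B.coneCovector_causal w (fun μ ↦ -fderiv ℝ q₁ w (E4.basisVector μ)) hν0 hn
    have hpos := B.sum_mul_normalCurrent_nonneg Φ w (fun μ ↦ -fderiv ℝ q₁ w (E4.basisVector μ))
      hc.1 hc.2
    have hsum : ∑ μ, fderiv ℝ q₁ w (E4.basisVector μ) * P μ =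
        -∑ μ, -fderiv ℝ q₁ w (E4.basisVector μ) * KerrSchild.normalCurrent B.inverseMetric Φ w μ := by
      rw [← Finset.sum_neg_distrib]
      exact Finset.sum_congr rfl fun μ _ ↦ by rw [hP]; ring
    rw [hsum]
    linarith
  · -- the horizon factor
    by_cases hq : 1 < q₂ w
    · exact Or.inl (deriv_smoothTransition_eq_zero_of_one_lt hq)
    · right
      -- in the layer `r ≤ r_in + δ`
      have hle : radius a w - (rPlus M a + ε * Real.exp ((w 0 - t₀) / (2 * M))) ≤ δ := by
        have h1 : q₂ w ≤ 1 := not_lt.mp hq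
        have h2 : δ⁻¹ * (radius a w - (rPlus M a + ε * Real.exp ((w 0 - t₀) / (2 * M)))) ≤ 1 := h1
        rwa [inv_mul_le_iff₀ hδ0, mul_one] at h2
      set s : ℝ := ε * Real.exp ((w 0 - t₀) / (2 * M)) / (2 * M) with hs
      have hs0 : 0 ≤ s := by positivity
      have hΔ : radius a w ^ 2 - 2 * M * radius a w + a ^ 2 ≤ 4 * M * radius a w * s := by
        have h1 := delta_le_mul_sub_rPlus hMa hw
        have hexp : Real.exp (-t₀ / (2 * M)) ≤ Real.exp ((w 0 - t₀) / (2 * M)) :=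
          Real.exp_le_exp.mpr (div_le_div_of_nonneg_right (by linarith) (by linarith))
        have h4M : 4 * M * s = 2 * (ε * Real.exp ((w 0 - t₀) / (2 * M))) := by
          rw [hs]; field_simp; norm_num
        have h2 : radius a w - rPlus M a ≤ 4 * M * s := by
          rw [h4M]
          rw [hδ] at hle
          nlinarith [mul_le_mul_of_nonneg_left hexp hε.le]
        calc radius a w ^ 2 - 2 * M * radius a w + a ^ 2
            ≤ radius a w * (radius a w - rPlus M a) := h1
          _ ≤ radius a w * (4 * M * s) := mul_le_mul_of_nonneg_left h2 hr0.le
          _ = 4 * M * radius a w * s := by ring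
      -- the covector `−δ dq₂ = ṙ_in dt* − dr`
      obtain ⟨hf0, hfi⟩ := horizonArg_fderiv_apply (rPlus M a) ε t₀ M δ hr0
      have hf1 := hfi 0
      have hf2 := hfi 1
      have hf3 := hfi 2
      simp only [Fin.succ_zero_eq_one, Fin.succ_one_eq_two] at hf1 hf2
      have h33 : (Fin.succ 2 : Fin 4) = 3 := rfl
      rw [h33] at hf3
      have hν0 : (fun μ ↦ -δ * fderiv ℝ q₂ w (E4.basisVector μ)) 0 = s := by
        show -δ * fderiv ℝ q₂ w (E4.basisVector 0) = s
        rw [hq₂, hf0, hs]; field_simp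
      have hν1 : (fun μ ↦ -δ * fderiv ℝ q₂ w (E4.basisVector μ)) 1 =
          -radiusGradVec a (E4.spatial w) 0 := by
        show -δ * fderiv ℝ q₂ w (E4.basisVector 1) = _
        rw [hq₂, hf1]; field_simp
      have hν2 : (fun μ ↦ -δ * fderiv ℝ q₂ w (E4.basisVector μ)) 2 =
          -radiusGradVec a (E4.spatial w) 1 := by
        show -δ * fderiv ℝ q₂ w (E4.basisVector 2) = _
        rw [hq₂, hf2]; field_simp
      have hν3 : (fun μ ↦ -δ * fderiv ℝ q₂ w (E4.basisVector μ)) 3 =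
          -radiusGradVec a (E4.spatial w) 2 := by
        show -δ * fderiv ℝ q₂ w (E4.basisVector 3) = _
        rw [hq₂, hf3]; field_simp
      have hφ : B.φ w = 2 * scalarH M a w := surgeryProfile_eq_of_le hrp hw.le
      have hcaus := horizonCovector_causal hM hr0 (φ := B.φ) hφ hs0 hΔ
        (fun μ ↦ -δ * fderiv ℝ q₂ w (E4.basisVector μ)) hν0 hν1 hν2 hν3
      have hpos := B.sum_mul_normalCurrent_nonneg Φ w
        (fun μ ↦ -δ * fderiv ℝ q₂ w (E4.basisVector μ)) hcaus.1 hcaus.2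
      have hsum : ∑ μ, fderiv ℝ q₂ w (E4.basisVector μ) * P μ =
          -δ⁻¹ * ∑ μ, -δ * fderiv ℝ q₂ w (E4.basisVector μ) *
            KerrSchild.normalCurrent B.inverseMetric Φ w μ := by
        rw [Finset.mul_sum]
        refine Finset.sum_congr rfl fun μ _ ↦ ?_
        rw [hP]
        field_simp
      rw [hsum]
      exact mul_nonpos_of_nonpos_of_nonneg (by simp [hδ0.le]) hpos

end Kerr

/-! ### The theorem -/

/-- **Finite speed of propagation in the ingoing Kerr–Schild chart (discharge of the named fact
`kerr_finite_speed_of_propagation`).** For subextremal `(M, a)` and a smooth solution `ψ` of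
`□_g ψ = 0` on the Kerr exterior `{r > r₊}` whose data on `{t* = 0} ∩ {r > r₊}` vanish at all
points with `‖x⃗‖ > ρ`, one has `ψ(x) = 0` and `dψ(x) = 0` at every exterior point with `x⁰ ≥ 0`
and `‖x⃗‖ > ρ + x⁰`. The printed source (Bär–Ginoux–Pfäffle 2007, Ch. 3 Sect. 2, Cor. 2.4 and
Thm. 2.9 of the arXiv version: uniqueness and `supp u ⊂ J^M(K)` for the Cauchy problem of a
normally hyperbolic operator on a globally hyperbolic manifold) is replaced by a self-contained
proof by the energy method in coordinates — Hawking–Ellis's conservation theorem (1973, §4.3) in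
weighted form (`KerrSchild.Background.fderiv_eq_zero_of_weight`) on the surgered Kerr–Schild
background, with the weight of `Kerr.dependenceWeight_flux_nonpos` (module docstring): its flux
condition is the dominant energy condition for the cone conormals `dt* + n⃗·dy⃗`, `|n⃗| < 1`
(Kerr–Schild light cones lie inside the coordinate cones, `H ≥ 0`) and for the horizon-layer
conormals `ṙ_in dt* − dr` (past causal curves in `{r > r₊}` do not reach `𝓗⁺` in finite `t*`,
DRSR arXiv:1402.7034, §2.2.5); `dψ` then vanishes along `[0, x⁰] × {x⃗}` and `ψ(x) = ψ(0, x⃗) = 0`.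
[cite: BarGinouxPfaffle2007, Ch. 3 Sect. 2 (Cor. 2.4, Thm. 2.9 of the arXiv version)] -/
theorem kerr_finite_speed_of_propagation_holds : kerr_finite_speed_of_propagation := by
  intro instF instS M a hMa ψ hψ hsol ρ hdata x hx0 hxfar
  classical
  have hM : 0 < M := hMa.pos
  have hrp : 0 < Kerr.rPlus M a := hMa.rPlus_pos
  -- ### the representative `Φ` of `ψ`
  set Φ : E4 → ℝ := Function.extend Subtype.val ψ 0 with hΦ_def
  have hrep : ∀ y : Kerr.exterior M a, ψ y = Φ y := fun y ↦
    (Subtype.val_injective.extend_apply _ _ y).symm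
  have hΦat : ∀ z : E4, z ∈ Kerr.exterior M a → ContDiffAt ℝ ∞ Φ z := fun z hz ↦
    (OpensChart.contMDiffAt_iff ⟨z, hz⟩ ψ Φ hrep).mp (hψ ⟨z, hz⟩)
  have hΦ2 : ∀ z ∈ (Kerr.exterior M a : Set E4), ContDiffAt ℝ 2 Φ z := fun z hz ↦
    (hΦat z hz).of_le (WithTop.coe_le_coe.mpr le_top)
  have hΦd : ∀ z : E4, z ∈ Kerr.exterior M a → DifferentiableAt ℝ Φ z := fun z hz ↦
    (hΦat z hz).differentiableAt (by simp)
  -- membership in the exterior from the radius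
  have hmem_of_lt : ∀ z : E4, Kerr.rPlus M a < Kerr.radius a z → z ∈ Kerr.exterior M a := by
    intro z hz
    rw [Kerr.mem_exterior, max_eq_left hrp.le]
    exact hz
  have hlt_of_mem : ∀ z : E4, z ∈ Kerr.exterior M a → Kerr.rPlus M a < Kerr.radius a z := by
    intro z hz
    have := Kerr.mem_exterior.mp hz
    rwa [max_eq_left hrp.le] at this
  -- ### the background and the wave equation in divergence form
  set B := Kerr.surgeryBackground M a (Kerr.rPlus M a) hM.le hrp with hB
  have hwave : ∀ z ∈ (Kerr.exterior M a : Set E4),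
      KerrSchild.waveOperator B.inverseMetric Φ z = 0 := by
    intro z hz
    have h1 := Kerr.dalembertian_eq_waveOperator M a (Kerr.rPlus M a) hrep ⟨z, hz⟩ (hΦ2 z hz)
    rw [KerrSchild.waveOperator_congr_of_eventuallyEq
      (Kerr.surgeryBackground_inverseMetric_eventuallyEq M a hM.le hrp ⟨z, hz⟩) Φ] at h1
    rw [← h1]
    exact hsol ⟨z, hz⟩
  -- ### the data in terms of `Φ`
  have hdataΦ : ∀ z : E4, z ∈ Kerr.exterior M a → z 0 = 0 → ρ < E4.spatialNorm z →
      Φ z = 0 ∧ fderiv ℝ Φ z = 0 := by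
    intro z hz hz0 hzρ
    have h := hdata ⟨z, hz⟩ hz0 hzρ
    exact ⟨(hrep ⟨z, hz⟩).symm.trans h.1,
      Kerr.fderiv_extend_eq_zero (by simp) hψ ⟨z, hz⟩ h.2⟩
  -- ### the point `x = (t₀, y₀)`
  set t₀ : ℝ := (x : E4) 0 with ht₀
  set y₀ : E3 := E4.spatial (x : E4) with hy₀
  have hxeq : (x : E4) = E4.ofTimeSpace t₀ y₀ := (E4.ofTimeSpace_time_spatial _).symm
  have hsn : E4.spatialNorm (x : E4) = ‖y₀‖ := rfl
  rw [hsn] at hxfar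
  rcases hx0.eq_or_lt with ht00 | ht0pos
  · exact hdata x ht00.symm (by rw [hsn]; linarith)
  have hr₀ : Kerr.rPlus M a < Kerr.radius a (x : E4) := hlt_of_mem _ x.2
  have hrad : ∀ t : ℝ, Kerr.radius a (E4.ofTimeSpace t y₀) = Kerr.radius a (x : E4) := by
    intro t
    rw [hxeq, Kerr.radius_ofTimeSpace a t y₀, Kerr.radius_ofTimeSpace a t₀ y₀]
  have hmem_t : ∀ t : ℝ, E4.ofTimeSpace t y₀ ∈ Kerr.exterior M a := fun t ↦
    hmem_of_lt _ (by rw [hrad t]; exact hr₀)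
  -- ### constants
  set R : ℝ := (t₀ + (‖y₀‖ - ρ)) / 2 with hR
  have hR1 : t₀ < R := by rw [hR]; linarith
  have hR2 : R < ‖y₀‖ - ρ := by rw [hR]; linarith
  set ε₁ : ℝ := (R - t₀) / 2 with hε₁
  have hε₁0 : 0 < ε₁ := by rw [hε₁]; linarith
  have hε₁R : ε₁ < R - t₀ := by rw [hε₁]; linarith
  set ε : ℝ := (Kerr.radius a (x : E4) - Kerr.rPlus M a) / 2 with hε
  have hε0 : 0 < ε := by rw [hε]; linarith
  have hεr : Kerr.rPlus M a + ε < Kerr.radius a (x : E4) := by rw [hε]; linarith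
  set δ : ℝ := ε * Real.exp (-t₀ / (2 * M)) with hδ
  have hδ0 : 0 < δ := mul_pos hε0 (Real.exp_pos _)
  set rK : ℝ := Kerr.rPlus M a + ε * Real.exp ((-1 - t₀) / (2 * M)) with hrK
  have hrK : Kerr.rPlus M a < rK := by
    rw [hrK]; linarith [mul_pos hε0 (Real.exp_pos ((-1 - t₀) / (2 * M)))]
  have hrIn_mono : ∀ {s t : ℝ}, s ≤ t →
      Kerr.rPlus M a + ε * Real.exp ((s - t₀) / (2 * M)) ≤
        Kerr.rPlus M a + ε * Real.exp ((t - t₀) / (2 * M)) := by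
    intro s t hst
    have : Real.exp ((s - t₀) / (2 * M)) ≤ Real.exp ((t - t₀) / (2 * M)) :=
      Real.exp_le_exp.mpr (div_le_div_of_nonneg_right (by linarith) (by linarith))
    nlinarith [hε0.le]
  -- ### the weight
  set W : E4 → ℝ := fun w ↦ Real.smoothTransition (2 * w 0 + 2) *
    (Real.smoothTransition (R - w 0 - √(ε₁ ^ 2 + ‖E4.spatial w - y₀‖ ^ 2)) *
      Real.smoothTransition (δ⁻¹ * (Kerr.radius a w -
        (Kerr.rPlus M a + ε * Real.exp ((w 0 - t₀) / (2 * M)))))) with hW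
  have hW1 : ContDiff ℝ 1 W :=
    Kerr.contDiff_dependenceWeight (n := 1) y₀ hε₁0.ne' hrp hε0.le hδ0
  have hW0 : ∀ w, 0 ≤ W w := fun w ↦
    Kerr.dependenceWeight_nonneg a (Kerr.rPlus M a) M t₀ R ε₁ ε δ y₀ w
  have hWsupp : ∀ w, W w ≠ 0 → -1 < w 0 ∧ ‖E4.spatial w - y₀‖ < R - w 0 ∧
      Kerr.rPlus M a + ε * Real.exp ((w 0 - t₀) / (2 * M)) < Kerr.radius a w :=
    fun w hw ↦ Kerr.dependenceWeight_support hδ0 hw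
  -- ### the compact set `K`
  set K : Set E4 := {w : E4 | w 0 ∈ Set.Icc (-1) R} ∩
    ({w : E4 | ‖E4.spatial w - y₀‖ ≤ R + 1} ∩ {w : E4 | rK ≤ Kerr.radius a w}) with hK
  have hKclosed : IsClosed K := by
    refine (isClosed_Icc.preimage (E4.dx 0).continuous).inter (IsClosed.inter ?_ ?_)
    · exact isClosed_le (continuous_norm.comp (E4.spatial.continuous.sub continuous_const))
        continuous_const
    · exact isClosed_le continuous_const (Kerr.continuous_radius a)
  have hKbdd : Bornology.IsBounded K := by
    refine isBounded_iff_forall_norm_le.mpr ⟨(1 + |R|) + (R + 1 + ‖y₀‖), fun w hw ↦ ?_⟩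
    obtain ⟨⟨h1, h2⟩, h3, -⟩ := hw
    have ht : |w 0| ≤ 1 + |R| := by
      rw [abs_le]
      constructor
      · linarith [abs_nonneg R]
      · linarith [le_abs_self R]
    have hs : E4.spatialNorm w ≤ R + 1 + ‖y₀‖ := by
      have : ‖E4.spatial w‖ ≤ ‖E4.spatial w - y₀‖ + ‖y₀‖ := by
        calc ‖E4.spatial w‖ = ‖(E4.spatial w - y₀) + y₀‖ := by rw [sub_add_cancel]
          _ ≤ ‖E4.spatial w - y₀‖ + ‖y₀‖ := norm_add_le _ _
      have h3' : ‖E4.spatial w - y₀‖ ≤ R + 1 := h3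
      change ‖E4.spatial w‖ ≤ _
      exact this.trans (by linarith [h3'])
    -- `‖w‖ ≤ |w⁰| + ‖w⃗‖`
    have hnorm : ‖w‖ ≤ |w 0| + E4.spatialNorm w := by
      have hs0 : 0 ≤ E4.spatialNorm w := E4.spatialNorm_nonneg w
      have hsq : ‖w‖ ^ 2 = w 0 ^ 2 + E4.spatialNorm w ^ 2 := by
        rw [EuclideanSpace.norm_sq_eq, Fin.sum_univ_four, E4.spatialNorm_sq]
        simp only [Real.norm_eq_abs, sq_abs]
        ring
      have h2 : ‖w‖ ^ 2 ≤ (|w 0| + E4.spatialNorm w) ^ 2 := by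
        rw [hsq]
        nlinarith [abs_nonneg (w 0), sq_abs (w 0)]
      exact (pow_le_pow_iff_left₀ (norm_nonneg w) (by positivity) two_ne_zero).mp h2
    linarith
  have hKc : IsCompact K := Metric.isCompact_of_isClosed_isBounded hKclosed hKbdd
  have hKU : K ⊆ (Kerr.exterior M a : Set E4) := fun w hw ↦
    hmem_of_lt w (hrK.trans_le hw.2.2)
  have hWK : ∀ w, W w ≠ 0 → w ∈ K := by
    intro w hw
    obtain ⟨h1, h2, h3⟩ := hWsupp w hw
    have hn : 0 ≤ ‖E4.spatial w - y₀‖ := norm_nonneg _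
    refine ⟨⟨h1.le, by linarith⟩, by show ‖E4.spatial w - y₀‖ ≤ R + 1; linarith, ?_⟩
    show rK ≤ Kerr.radius a w
    exact ((hrIn_mono (show (-1 : ℝ) ≤ w 0 by linarith)).trans h3.le)
  -- ### the hypotheses of the conservation theorem
  have hsolK : ∀ w ∈ K, KerrSchild.waveOperator B.inverseMetric Φ w = 0 := fun w hw ↦
    hwave w (hKU hw)
  have hflux : ∀ w ∈ K, 0 ≤ w 0 → w 0 ≤ t₀ →
      ∑ μ, fderiv ℝ W w (E4.basisVector μ) *
        KerrSchild.normalCurrent B.inverseMetric Φ w μ ≤ 0 := fun w hw hw0 _ ↦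
    Kerr.dependenceWeight_flux_nonpos hMa hM.le hrp hε₁0.ne' hε0 rfl y₀ Φ
      (hrK.trans_le hw.2.2) hw0
  have hdataW : ∀ w, w 0 = 0 → W w ≠ 0 → fderiv ℝ Φ w = 0 := by
    intro w hw0 hw
    obtain ⟨-, h2, h3⟩ := hWsupp w hw
    rw [hw0, sub_zero] at h2
    have hmem : w ∈ Kerr.exterior M a := by
      refine hmem_of_lt w (lt_of_le_of_lt ?_ h3)
      linarith [mul_pos hε0 (Real.exp_pos ((w 0 - t₀) / (2 * M)))]
    refine (hdataΦ w hmem hw0 ?_).2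
    have hy : ‖y₀‖ - ‖E4.spatial w‖ ≤ ‖E4.spatial w - y₀‖ := by
      rw [← norm_sub_rev]; exact norm_sub_norm_le _ _
    change ρ < ‖E4.spatial w‖
    linarith
  -- ### `dΦ = 0` along the segment `[0, t₀] × {y₀}`
  have hseg : ∀ t ∈ Set.Icc (0 : ℝ) t₀, fderiv ℝ Φ (E4.ofTimeSpace t y₀) = 0 := by
    intro t ht
    have hWt : W (E4.ofTimeSpace t y₀) ≠ 0 :=
      Kerr.dependenceWeight_ne_zero_segment hM hε₁0 hε₁R hε0.le hδ0 ht.1 ht.2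
        (by rw [hrad t]; exact hεr)
    exact B.fderiv_eq_zero_of_weight hKc hKU hΦ2 hW1 hW0 hWK hsolK hflux hdataW
      (x := E4.ofTimeSpace t y₀) (by simpa using ht.1) (by simpa using ht.2) hWt
  -- ### conclusion
  have hy₀ρ : ρ < ‖y₀‖ := by linarith
  have hdata0 : Φ (E4.ofTimeSpace 0 y₀) = 0 :=
    (hdataΦ _ (hmem_t 0) (by simp) (by rw [E4.spatialNorm_ofTimeSpace]; exact hy₀ρ)).1
  refine ⟨?_, ?_⟩
  · -- `ψ x = Φ(t₀, y₀) = Φ(0, y₀) = 0`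
    rw [hrep x, hxeq]
    have hderiv : ∀ t, HasDerivAt (fun t ↦ Φ (E4.ofTimeSpace t y₀))
        (fderiv ℝ Φ (E4.ofTimeSpace t y₀) (E4.basisVector 0)) t := by
      intro t
      have hl : HasDerivAt (fun t : ℝ ↦ E4.ofTimeSpace t y₀) (E4.basisVector 0) t :=
        E4.hasDerivAt_ofTimeSpace_left t y₀
      have hF : HasFDerivAt Φ (fderiv ℝ Φ (E4.ofTimeSpace t y₀)) (E4.ofTimeSpace t y₀) :=
        (hΦd _ (hmem_t t)).hasFDerivAt
      exact hF.comp_hasDerivAt t hl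
    have hg : ∀ t ∈ Set.Icc 0 t₀, Φ (E4.ofTimeSpace t y₀) = Φ (E4.ofTimeSpace 0 y₀) := by
      refine constant_of_has_deriv_right_zero
        (fun t _ ↦ (hderiv t).continuousAt.continuousWithinAt) fun t ht ↦ ?_
      have := hderiv t
      rw [hseg t ⟨ht.1, ht.2.le⟩, zero_apply] at this
      exact this.hasDerivWithinAt
    rw [hg t₀ ⟨hx0, le_rfl⟩]
    exact hdata0
  · rw [OpensChart.mfderiv_eq x ψ Φ hrep (hΦd _ x.2), hxeq]
    exact hseg t₀ ⟨hx0, le_rfl⟩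

end Literature.Geometry.Lorentzian

end
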